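import Mathlib
import Literature.Probability.Percolation.BlockResampling
import HarnessLib

/-!
# `stub_condHarris` of line `SketchIdeator1` (crux `TetrahedronHarrisGap`, stmt-CriticalPhenomena-7799):
# conditional Harris inside a finite block of edges, integrated

Registered stub `stub_condHarris` of the lead's skeleton
`Cruxes/TetrahedronHarrisGap/Lines/SketchIdeator1.lean` (card `corner-ball-total-covariance`), restated
DEF-FREE over tree declarations and landed.

Statement: for Bernoulli bond percolation `P_p = bondPercolation G p` on a countable simple graph `G`, a
finite block `B` of edges and two increasing measurable events `A, A'`,
`∫ P_p(A | ω off B) · P_p(A' | ω off B) dP_p(ω) ≤ P_p(A ∩ A')`,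
where `P_p(E | ω off B) = blockCondProb G p B E ω` is the written-out conditional probability of
`BlockResampling.lean`.  The route's instance is `G = zdGraph 3` (`stub_condHarris`).

Proof: pointwise in `ω`, `blockCondProb G p B E ω = P_p{ζ | ω ∖ B ∪ obs ζ B ∈ E}`
(`blockCondProb_eq_real`); for an upper set `E` the glued event `{ζ | ω ∖ B ∪ obs ζ B ∈ E}` is increasing and
measurable (it is read off the block: `isUpperSet_setOf_comp_obs`, `measurableSet_setOf_comp_obs`), and the
glued event of `A ∩ A'` is the intersection of those of `A` and `A'`, so Harris–FKG (`harris_fkg_holds`) gives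
`P_p(A | ω off B) P_p(A' | ω off B) ≤ P_p(A ∩ A' | ω off B)`.  Integrating (`integral_mono`, everything is
measurable and `[0,1]`-valued), `∫ P_p(A ∩ A' | ω off B) dP_p = P_p(A ∩ A')` by the finite Fubini identity
`integral_sum_powerset_eq` and `integral_indicator_one`.
-/

noncomputable section

namespace Summit.CriticalPhenomena.PercolationContinuityZ3.Theorems.TetrahedronHarrisGap

open MeasureTheory
open Literature.Probability.Percolation Literature.Probability.LatticeModels

section General

variable {V : Type*}

/-- The glued event `{ζ | ω ∖ B ∪ obs ζ B ∈ E}` is measurable: it is read off the finite block `B`. -/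
theorem measurableSet_setOf_sdiff_union_obs_mem (B : Finset (Sym2 V)) (E : Set (BondConfig V))
    (ω : BondConfig V) : MeasurableSet {ζ : BondConfig V | ω \ ↑B ∪ ↑(obs ζ B) ∈ E} :=
  measurableSet_setOf_comp_obs B (fun ξ => ω \ ↑B ∪ ↑ξ ∈ E)

/-- For an increasing event `E`, the glued event `{ζ | ω ∖ B ∪ obs ζ B ∈ E}` is increasing
(`ζ ↦ ω ∖ B ∪ obs ζ B` is monotone). -/
theorem isUpperSet_setOf_sdiff_union_obs_mem (B : Finset (Sym2 V)) {E : Set (BondConfig V)}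
    (hE : IsUpperSet E) (ω : BondConfig V) :
    IsUpperSet {ζ : BondConfig V | ω \ ↑B ∪ ↑(obs ζ B) ∈ E} :=
  isUpperSet_setOf_comp_obs (B := B) (P := fun ξ => ω \ ↑B ∪ ↑ξ ∈ E) fun _ _ hξ _ h =>
    hE (Set.union_subset_union_right _ (Finset.coe_subset.2 hξ)) h

/-- The glued event of an intersection is the intersection of the glued events. -/
theorem setOf_sdiff_union_obs_mem_inter (B : Finset (Sym2 V)) (A A' : Set (BondConfig V))
    (ω : BondConfig V) :
    {ζ : BondConfig V | ω \ ↑B ∪ ↑(obs ζ B) ∈ A ∩ A'} =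
      {ζ : BondConfig V | ω \ ↑B ∪ ↑(obs ζ B) ∈ A} ∩ {ζ : BondConfig V | ω \ ↑B ∪ ↑(obs ζ B) ∈ A'} :=
  rfl

variable [Countable V] (G : SimpleGraph V) (p : unitInterval)

/-- **Conditional Harris inside a block, pointwise**: for increasing events `A, A'` and every outside
configuration `ω`, `P_p(A | ω off B) · P_p(A' | ω off B) ≤ P_p(A ∩ A' | ω off B)` (Harris–FKG for the
product law of the block, `harris_fkg_holds`, applied to the glued events). -/
theorem blockCondProb_mul_blockCondProb_le (B : Finset (Sym2 V)) {A A' : Set (BondConfig V)}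
    (hA : IsUpperSet A) (hA' : IsUpperSet A') (ω : BondConfig V) :
    blockCondProb G p B A ω * blockCondProb G p B A' ω ≤ blockCondProb G p B (A ∩ A') ω := by
  rw [blockCondProb_eq_real, blockCondProb_eq_real, blockCondProb_eq_real,
    setOf_sdiff_union_obs_mem_inter]
  exact harris_fkg_holds G p (isUpperSet_setOf_sdiff_union_obs_mem B hA ω)
    (isUpperSet_setOf_sdiff_union_obs_mem B hA' ω) (measurableSet_setOf_sdiff_union_obs_mem B A ω)
    (measurableSet_setOf_sdiff_union_obs_mem B A' ω)

/-- **Tower property**: `∫ P_p(E | ω off B) dP_p(ω) = P_p(E)` for a measurable event `E` (finite Fubini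
over the block, `integral_sum_powerset_eq`). -/
theorem integral_blockCondProb_eq (B : Finset (Sym2 V)) {E : Set (BondConfig V)}
    (hE : MeasurableSet E) :
    ∫ ω, blockCondProb G p B E ω ∂(bondPercolation G p) = (bondPercolation G p).real E := by
  unfold blockCondProb
  rw [integral_sum_powerset_eq G p B (F := E.indicator 1) (measurable_one.indicator hE) (K := 1)
    (abs_indicator_one_le E), integral_indicator_one hE]

/-- `P_p(E | ω off B)` is integrable (measurable and `[0,1]`-valued under a probability measure). -/
theorem integrable_blockCondProb (B : Finset (Sym2 V)) {E : Set (BondConfig V)}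
    (hE : MeasurableSet E) : Integrable (blockCondProb G p B E) (bondPercolation G p) :=
  Integrable.of_bound (measurable_blockCondProb G p B hE).aestronglyMeasurable 1
    (ae_of_all _ fun ω => by
      rw [Real.norm_eq_abs]
      exact abs_blockCondProb_le G p B E ω)

/-- The product `P_p(A | ω off B) · P_p(A' | ω off B)` is integrable. -/
theorem integrable_blockCondProb_mul (B : Finset (Sym2 V)) {A A' : Set (BondConfig V)}
    (hAm : MeasurableSet A) (hA'm : MeasurableSet A') :
    Integrable (fun ω => blockCondProb G p B A ω * blockCondProb G p B A' ω) (bondPercolation G p) :=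
  Integrable.of_bound ((measurable_blockCondProb G p B hAm).mul
      (measurable_blockCondProb G p B hA'm)).aestronglyMeasurable 1
    (ae_of_all _ fun ω => by
      rw [Real.norm_eq_abs, abs_mul]
      exact mul_le_one₀ (abs_blockCondProb_le G p B A ω) (abs_nonneg _)
        (abs_blockCondProb_le G p B A' ω))

/-- **Conditional Harris inside a block, integrated**: for increasing measurable events `A, A'` and a
finite block `B` of edges, `∫ P_p(A | ω off B) · P_p(A' | ω off B) dP_p(ω) ≤ P_p(A ∩ A')`. -/
theorem integral_blockCondProb_mul_blockCondProb_le (B : Finset (Sym2 V)) {A A' : Set (BondConfig V)}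
    (hA : IsUpperSet A) (hA' : IsUpperSet A') (hAm : MeasurableSet A) (hA'm : MeasurableSet A') :
    ∫ ω, blockCondProb G p B A ω * blockCondProb G p B A' ω ∂(bondPercolation G p) ≤
      (bondPercolation G p).real (A ∩ A') := by
  rw [← integral_blockCondProb_eq G p B (hAm.inter hA'm)]
  exact integral_mono (integrable_blockCondProb_mul G p B hAm hA'm)
    (integrable_blockCondProb G p B (hAm.inter hA'm))
    fun ω => blockCondProb_mul_blockCondProb_le G p B hA hA' ω

end General

/-- **`stub_condHarris`** (registered stub of line `SketchIdeator1`, crux stmt-CriticalPhenomena-7799,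
exact registered signature): conditional Harris inside a finite block of edges of `ℤ³`, integrated —
for increasing measurable events `A, A'`, `∫ P_p(A | ω off B) · P_p(A' | ω off B) dP_p(ω) ≤ P_p(A ∩ A')`. -/
theorem stub_condHarris :
    ∀ (p : unitInterval) (B : Finset (Sym2 (Site 3))) (A A' : Set (BondConfig (Site 3))),
      IsUpperSet A → IsUpperSet A' → MeasurableSet A → MeasurableSet A' →
      ∫ ω, blockCondProb (zdGraph 3) p B A ω * blockCondProb (zdGraph 3) p B A' ω
          ∂(bondPercolation (zdGraph 3) p) ≤
        (bondPercolation (zdGraph 3) p).real (A ∩ A') :=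
  fun p B _ _ hA hA' hAm hA'm =>
    integral_blockCondProb_mul_blockCondProb_le (zdGraph 3) p B hA hA' hAm hA'm

end Summit.CriticalPhenomena.PercolationContinuityZ3.Theorems.TetrahedronHarrisGap

end
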